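import Summits.ResolutionOfSingularities.ResolutionOfSingularities.Theorems.UniversalCellsCampaignW82RegularTwistLocus
import Summits.ResolutionOfSingularities.ResolutionOfSingularities.Theorems.UniversalCellsCampaignW82RegularFormProofs
import Literature.AlgebraicGeometry.Resolution.RegularLocusDense
import Mathlib.AlgebraicGeometry.Geometrically.Reduced
import Mathlib.FieldTheory.Perfect
import HarnessLib

/-!
# [OURS · L1 W8.2] GENERIC SMOOTHNESS THROUGH THE TWIST: over `M(t)` (`M` perfect) the smooth locus of a variety
# whose Frobenius twist is reduced is DENSE — every model of an admissible `X₀^{(p^e)}` is smooth on a dense open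

Cell `res-hironaka` (run/shared/lean/pub/res-hironaka/), LADDER-RESOLUTION rung L (RESCUE), slot W8.2; host route
`UniversalCells`, host item `PrimeFieldToPerfect` (stmt-ResolutionOfSingularities-15233), door 1. Theses-free
proofs file, written by res-L1-s82-pv-1 (gen 5), combining `smoothLocus_eq_image_regularLocus_twist`
(…RegularTwistLocus: `sm q = pr₁ (Reg Y^{(p)})`) with the tree's `Scheme.dense_regularLocus` (the regular locus
of a REDUCED scheme contains the maximal points, hence is dense).

* `isIntegral_twist_of_integralOverPerfectClosure` — over any field `K` of characteristic `p`: if `X₀ ×_K L` is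
  integral for a perfect purely inseparable `L ⊇ K` (the slot's `IntegralOverPerfectClosure K f₀`), then the twist
  `X₀^{(p)} = X₀ ×_{K,Frob} K` is integral (`Spec L → Spec K` factors through `Spec Frob_K` via
  `Frob_L⁻¹ ∘ algebraMap`; flat surjective descent).
* **`dense_smoothLocus_of_isReduced_twist`** — `K = M(t)`, `M` perfect, `q : Y → Spec K` of finite type with
  `Y^{(p)}` REDUCED: `Scheme.Hom.smoothLocus q` is DENSE in `Y`.
* `dense_smoothLocus_of_geometricallyReduced` (Mathlib `GeometricallyReduced q`),
  **`dense_smoothLocus_of_integralOverPerfectClosure`** (the slot's hypothesis).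
* `integralOverPerfectClosure_twist` — admissibility passes to every Frobenius twist `X₀^{(p^e)}` (any `K`:
  `Frob_L^e` is an automorphism of the perfect `L` intertwining `algebraMap ∘ Frob_K^e` and `algebraMap`); with the
  tree's `integralOverPerfectClosure_of_isBirational` (…RegularFormProofs) this gives
  **`dense_smoothLocus_model_of_twist`**: every INTEGRAL proper birational model `Y → X₀^{(p^e)}` of an admissible
  `X₀` of the W8.2 residual is smooth over `M(t)` on a DENSE open — its defect `pr₁ (Sing Y^{(p)})`
  (…RegularTwistLocus) is a nowhere dense closed subset; the residual asks to make it empty.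

HONEST FRAMING. OURS theorems (role replaced: §17 ¶2 p.89 l.59–62 of [Hironaka2017], typed AS PRINTED as
`S17Methodology.U89_3`); NOT statements of the manuscript; nothing attributed to its author; generic smoothness in
the slot's idiom, not progress on the open residual. AI work, weaker than expert review; no claim beyond the kernel.
-/

noncomputable section

set_option linter.dupNamespace false -- mandated namespace of this single-conjunct summit

open CategoryTheory CategoryTheory.Limits AlgebraicGeometry TopologicalSpace
open Literature.AlgebraicGeometry.Resolution

namespace Summit.ResolutionOfSingularities.ResolutionOfSingularities.Theorems.CampaignW82

/-! ## The twist of a scheme integral over the perfect closure is integral -/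

/-- **The Frobenius twist of a scheme integral over the perfect closure is integral** (any field `K` of
characteristic `p`): `Spec L → Spec K` factors as `Spec L → Spec K —Spec Frob→ Spec K` (`L` perfect: the first map
is `Spec` of `Frob_L⁻¹ ∘ algebraMap`), so `X₀ ×_K L ≅ X₀^{(p)} ×_{Spec K} Spec L → X₀^{(p)}` is flat and surjective and
integrality descends. [folklore] -/
theorem isIntegral_twist_of_integralOverPerfectClosure (p : ℕ) [Fact p.Prime] (K : Type) [Field K] [CharP K p]
    {X₀ : Scheme.{0}} (f₀ : X₀ ⟶ Spec (.of K)) (h : IntegralOverPerfectClosure K f₀) :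
    IsIntegral (pullback f₀ (Spec.map (CommRingCat.ofHom (frobenius K p)))) := by
  obtain ⟨L, _, _, _, _, hXL⟩ := h
  haveI := hXL
  haveI : ExpChar L p := by
    haveI : CharP L p := (charP_of_injective_algebraMap (algebraMap K L).injective p)
    infer_instance
  haveI : PerfectRing L p := PerfectField.toPerfectRing p
  -- `φ = Frob_L⁻¹ ∘ algebraMap : K → L` with `φ ∘ Frob_K = algebraMap`
  let φ : K →+* L := (frobeniusEquiv L p).symm.toRingHom.comp (algebraMap K L)
  have hφ : φ.comp (frobenius K p) = algebraMap K L := by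
    refine RingHom.ext fun a => ?_
    change (frobeniusEquiv L p).symm (algebraMap K L (frobenius K p a)) = algebraMap K L a
    rw [frobenius_def, map_pow, ← frobenius_def, ← coe_frobeniusEquiv, RingEquiv.symm_apply_apply]
  have hfac : Spec.map (CommRingCat.ofHom φ) ≫ Spec.map (CommRingCat.ofHom (frobenius K p)) =
      Spec.map (CommRingCat.ofHom (algebraMap K L)) := by
    rw [← Spec.map_comp, ← CommRingCat.ofHom_comp, hφ]
  -- `X₀ ×_K L ≅ X₀^{(p)} ×_{Spec K} Spec L`; descend integrality along the flat surjective projection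
  let e := (pullbackLeftPullbackSndIso f₀ (Spec.map (CommRingCat.ofHom (frobenius K p)))
      (Spec.map (CommRingCat.ofHom φ)) ≪≫ pullback.congrHom rfl hfac)
  haveI : Flat (Spec.map (CommRingCat.ofHom φ)) := DeJong1996.Stage.flat_specMap _
  haveI : Surjective (Spec.map (CommRingCat.ofHom φ)) := DeJong1996.Stage.surjective_specMap _
  haveI : Flat (pullback.fst (pullback.snd f₀ (Spec.map (CommRingCat.ofHom (frobenius K p))))
      (Spec.map (CommRingCat.ofHom φ))) := MorphismProperty.pullback_fst _ _ inferInstance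
  haveI : Surjective (pullback.fst (pullback.snd f₀ (Spec.map (CommRingCat.ofHom (frobenius K p))))
      (Spec.map (CommRingCat.ofHom φ))) := MorphismProperty.pullback_fst _ _ inferInstance
  haveI : IsIntegral (pullback (pullback.snd f₀ (Spec.map (CommRingCat.ofHom (frobenius K p))))
      (Spec.map (CommRingCat.ofHom φ))) :=
    DeJong1996.Stage.isIntegral_of_flat_surjective e.inv
  exact DeJong1996.Stage.isIntegral_of_flat_surjective
    (pullback.fst (pullback.snd f₀ (Spec.map (CommRingCat.ofHom (frobenius K p))))
      (Spec.map (CommRingCat.ofHom φ)))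

/-- **Admissibility passes to Frobenius twists**: if `X₀ ×_K L` is integral for a perfect purely inseparable
`L ⊇ K`, so is `X₀^{(p^e)} ×_K L` — it is isomorphic to `X₀ ×_K L`, because `Frob_L^e` is an automorphism of `L` with
`algebraMap ∘ Frob_K^e = Frob_L^e ∘ algebraMap` (so `X₀^{(p^e)} ×_K L ≅ (X₀ ×_K L) ×_{L,Frob_L^e} L ≅ X₀ ×_K L`).
[folklore] -/
theorem integralOverPerfectClosure_twist (p : ℕ) [Fact p.Prime] (K : Type) [Field K] [CharP K p]
    {X₀ : Scheme.{0}} (f₀ : X₀ ⟶ Spec (.of K)) (h : IntegralOverPerfectClosure K f₀) (e : ℕ) :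
    IntegralOverPerfectClosure K
      (pullback.snd f₀ (Spec.map (CommRingCat.ofHom (iterateFrobenius K p e)))) := by
  obtain ⟨L, iF, iP, iA, iPI, hXL⟩ := h
  haveI := hXL
  haveI : ExpChar L p := by
    haveI : CharP L p := (charP_of_injective_algebraMap (algebraMap K L).injective p)
    infer_instance
  haveI : PerfectRing L p := PerfectField.toPerfectRing p
  refine ⟨L, iF, iP, iA, iPI, ?_⟩
  have hcomm : (algebraMap K L).comp (iterateFrobenius K p e) = (iterateFrobenius L p e).comp (algebraMap K L) := by
    refine RingHom.ext fun a => ?_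
    simp only [RingHom.comp_apply, iterateFrobenius_def, map_pow]
  have hfac : Spec.map (CommRingCat.ofHom (algebraMap K L)) ≫
      Spec.map (CommRingCat.ofHom (iterateFrobenius K p e)) =
        Spec.map (CommRingCat.ofHom (iterateFrobenius L p e)) ≫ Spec.map (CommRingCat.ofHom (algebraMap K L)) := by
    rw [← Spec.map_comp, ← Spec.map_comp, ← CommRingCat.ofHom_comp, ← CommRingCat.ofHom_comp, hcomm]
  -- `P = X₀^{(p^e)} ×_K L ≅ X₀ ×_K (L via alg ∘ Frob_K^e = Frob_L^e ∘ alg) ≅ (X₀ ×_K L) ×_{L, Frob_L^e} L =: Q`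
  let e₁ : pullback (pullback.snd f₀ (Spec.map (CommRingCat.ofHom (iterateFrobenius K p e))))
        (Spec.map (CommRingCat.ofHom (algebraMap K L))) ≅
      pullback (pullback.snd f₀ (Spec.map (CommRingCat.ofHom (algebraMap K L))))
        (Spec.map (CommRingCat.ofHom (iterateFrobenius L p e))) :=
    pullbackLeftPullbackSndIso f₀ (Spec.map (CommRingCat.ofHom (iterateFrobenius K p e)))
        (Spec.map (CommRingCat.ofHom (algebraMap K L))) ≪≫
      pullback.congrHom rfl hfac ≪≫
      (pullbackLeftPullbackSndIso f₀ (Spec.map (CommRingCat.ofHom (algebraMap K L)))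
        (Spec.map (CommRingCat.ofHom (iterateFrobenius L p e)))).symm
  -- `Spec Frob_L^e` is an isomorphism (`L` perfect), hence so is `pr₁ : Q → X₀ ×_K L`
  haveI : IsIso (CommRingCat.ofHom (iterateFrobenius L p e)) :=
    ⟨⟨CommRingCat.ofHom (iterateFrobeniusEquiv L p e).symm.toRingHom,
      by ext x; exact (iterateFrobeniusEquiv L p e).symm_apply_apply x,
      by ext x; exact (iterateFrobeniusEquiv L p e).apply_symm_apply x⟩⟩
  haveI : IsIso (pullback.fst (pullback.snd f₀ (Spec.map (CommRingCat.ofHom (algebraMap K L))))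
      (Spec.map (CommRingCat.ofHom (iterateFrobenius L p e)))) := inferInstance
  haveI : IsIntegral (pullback (pullback.snd f₀ (Spec.map (CommRingCat.ofHom (algebraMap K L))))
      (Spec.map (CommRingCat.ofHom (iterateFrobenius L p e)))) :=
    DeJong1996.Stage.isIntegral_of_flat_surjective
      (inv (pullback.fst (pullback.snd f₀ (Spec.map (CommRingCat.ofHom (algebraMap K L))))
        (Spec.map (CommRingCat.ofHom (iterateFrobenius L p e)))))
  exact DeJong1996.Stage.isIntegral_of_flat_surjective e₁.inv

/-! ## Density of the smooth locus -/

section PerfectConstants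

variable (p : ℕ) [Fact p.Prime] (M : Type) [Field M] [CharP M p] [PerfectField M] {Y : Scheme.{0}}
  (q : Y ⟶ Spec (.of (RatFunc M))) [LocallyOfFiniteType q] [QuasiCompact q] [LocallyOfFinitePresentation q]

/-- **GENERIC SMOOTHNESS THROUGH THE TWIST.** Over `K = M(t)`, `M` perfect, for `q : Y → Spec K` of finite type whose
Frobenius twist `Y^{(p)}` is REDUCED (e.g. `Y` geometrically reduced), the smooth locus of `q` is DENSE: it is
`pr₁ (Reg Y^{(p)})` (`smoothLocus_eq_image_regularLocus_twist`), the regular locus of a reduced scheme is dense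
(tree `Scheme.dense_regularLocus`), and `pr₁` is continuous and surjective. (`LocallyOfFinitePresentation q` holds
for every `q` locally of finite type over a field; it is a hypothesis only to name `q.smoothLocus`.)
[cite: EGAIV2, Prop. 6.7.4] -/
theorem dense_smoothLocus_of_isReduced_twist
    [IsReduced (pullback q (Spec.map (CommRingCat.ofHom (frobenius (RatFunc M) p))))] :
    Dense (q.smoothLocus : Set Y) := by
  haveI : Surjective (Spec.map (CommRingCat.ofHom (frobenius (RatFunc M) p))) :=
    DeJong1996.Stage.surjective_specMap _
  haveI : Surjective (pullback.fst q (Spec.map (CommRingCat.ofHom (frobenius (RatFunc M) p)))) :=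
    MorphismProperty.pullback_fst _ _ inferInstance
  rw [smoothLocus_eq_image_regularLocus_twist p M q]
  exact (pullback.fst q (Spec.map (CommRingCat.ofHom (frobenius (RatFunc M) p)))).surjective.denseRange.dense_image
    (pullback.fst q _).continuous (Scheme.dense_regularLocus _)

end PerfectConstants

/-- **Generic smoothness for GEOMETRICALLY REDUCED `q`** (Mathlib `GeometricallyReduced`) over `M(t)`, `M` perfect of
characteristic `p`: the twist, a base change along `Spec Frob_K`, is reduced, so `dense_smoothLocus_of_isReduced_twist`
applies. (The prime `p` with `CharP M p` is an explicit argument; it does not occur in the statement.)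
[cite: EGAIV2, Prop. 6.7.4] -/
theorem dense_smoothLocus_of_geometricallyReduced (p : ℕ) [Fact p.Prime] (M : Type) [Field M] [CharP M p]
    [PerfectField M] {Y : Scheme.{0}} (q : Y ⟶ Spec (.of (RatFunc M))) [LocallyOfFiniteType q] [QuasiCompact q]
    [LocallyOfFinitePresentation q] [GeometricallyReduced q] : Dense (q.smoothLocus : Set Y) := by
  haveI : IsReduced (pullback q (Spec.map (CommRingCat.ofHom (frobenius (RatFunc M) p)))) :=
    pullback_of_geometrically (P := fun X : Scheme.{0} => IsReduced X)
      (GeometricallyReduced.geometrically_isReduced (f := q)) (RatFunc M) _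
  exact dense_smoothLocus_of_isReduced_twist p M q

/-- **Generic smoothness under the slot's hypothesis `IntegralOverPerfectClosure (RatFunc M) q`** (the twist is then
integral, `isIntegral_twist_of_integralOverPerfectClosure`). For the W8.2 residual: EVERY proper birational model
`Y` of an admissible `X₀^{(p^e)}` is smooth over `M(t)` on a dense open subset; its defect `pr₁ (Sing Y^{(p)})`
(…RegularTwistLocus) is a nowhere dense closed subset of `Y`. [cite: EGAIV2, Prop. 6.7.4] -/
theorem dense_smoothLocus_of_integralOverPerfectClosure (p : ℕ) [Fact p.Prime] (M : Type) [Field M] [CharP M p]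
    [PerfectField M] {Y : Scheme.{0}} (q : Y ⟶ Spec (.of (RatFunc M))) [LocallyOfFiniteType q] [QuasiCompact q]
    [LocallyOfFinitePresentation q] (h : IntegralOverPerfectClosure (RatFunc M) q) :
    Dense (q.smoothLocus : Set Y) := by
  haveI := isIntegral_twist_of_integralOverPerfectClosure p (RatFunc M) q h
  exact dense_smoothLocus_of_isReduced_twist p M q

/-- In particular the smooth locus is NON-EMPTY as soon as `Y` is (dense in a non-empty space). [folklore] -/
theorem smoothLocus_nonempty_of_integralOverPerfectClosure (p : ℕ) [Fact p.Prime] (M : Type) [Field M]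
    [CharP M p] [PerfectField M] {Y : Scheme.{0}} (q : Y ⟶ Spec (.of (RatFunc M))) [LocallyOfFiniteType q]
    [QuasiCompact q] [LocallyOfFinitePresentation q] [Nonempty Y] (h : IntegralOverPerfectClosure (RatFunc M) q) :
    (q.smoothLocus : Set Y).Nonempty :=
  (dense_smoothLocus_of_integralOverPerfectClosure p M q h).nonempty

/-- **EVERY INTEGRAL MODEL OF A TWIST OF AN ADMISSIBLE `X₀` IS SMOOTH ON A DENSE OPEN.** Over `K = M(t)`, `M` perfect:
for `f₀ : X₀ → Spec K` of finite type with `IntegralOverPerfectClosure K f₀` (the W8.2 residual's admissibility),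
any level `e`, and any birational `π : Y → X₀^{(p^e)}` from an INTEGRAL `Y` (e.g. a resolution), the smooth locus of
`Y → Spec K` is dense — by `integralOverPerfectClosure_twist`, the tree's `integralOverPerfectClosure_of_isBirational`
and `dense_smoothLocus_of_integralOverPerfectClosure`. Its complement, the defect `pr₁ (Sing Y^{(p)})`, is nowhere
dense; the residual asks for `e` and `Y` making it empty. [cite: EGAIV2, Prop. 6.7.4] -/
theorem dense_smoothLocus_model_of_twist (p : ℕ) [Fact p.Prime] (M : Type) [Field M] [CharP M p] [PerfectField M]
    {X₀ Y : Scheme.{0}} (f₀ : X₀ ⟶ Spec (.of (RatFunc M))) [LocallyOfFiniteType f₀] [QuasiCompact f₀]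
    (h : IntegralOverPerfectClosure (RatFunc M) f₀) (e : ℕ) [IsIntegral Y]
    (π : Y ⟶ pullback f₀ (Spec.map (CommRingCat.ofHom (iterateFrobenius (RatFunc M) p e))))
    [LocallyOfFiniteType (π ≫ pullback.snd f₀ (Spec.map (CommRingCat.ofHom (iterateFrobenius (RatFunc M) p e))))]
    [QuasiCompact (π ≫ pullback.snd f₀ (Spec.map (CommRingCat.ofHom (iterateFrobenius (RatFunc M) p e))))]
    [LocallyOfFinitePresentation
      (π ≫ pullback.snd f₀ (Spec.map (CommRingCat.ofHom (iterateFrobenius (RatFunc M) p e))))]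
    (hπ : IsBirational π) :
    Dense ((π ≫ pullback.snd f₀ (Spec.map (CommRingCat.ofHom (iterateFrobenius (RatFunc M) p e)))).smoothLocus :
      Set Y) :=
  dense_smoothLocus_of_integralOverPerfectClosure p M _
    (integralOverPerfectClosure_of_isBirational
      (pullback.snd f₀ (Spec.map (CommRingCat.ofHom (iterateFrobenius (RatFunc M) p e)))) _ π rfl hπ
      (integralOverPerfectClosure_twist p (RatFunc M) f₀ h e))

end Summit.ResolutionOfSingularities.ResolutionOfSingularities.Theorems.CampaignW82

end
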